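import Summits.Parity.GeneralizedHardyLittlewood.Theorems.LeeYangFibresAbsoluteUpgradeUniformDefs
import Summits.Parity.GeneralizedHardyLittlewood.Theorems.LeeYangFibresAbsoluteUpgradeUniformGrowth
import Summits.Parity.GeneralizedHardyLittlewood.Theorems.LeeYangFibresAbsoluteUpgradeUniformAmplificationAux
import Summits.Parity.GeneralizedHardyLittlewood.Theorems.LeeYangFibresRelativeDimOneAmplificationAux
import Summits.Parity.GeneralizedHardyLittlewood.Theorems.LeeYangFibresRelativeDimOneTightness
import Summits.Parity.GeneralizedHardyLittlewood.Theorems.LeeYangFibresRelativeDimOne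
import Summits.Parity.GeneralizedHardyLittlewood.Theorems.LeeYangFibresAbsoluteUpgradeSingularProductLogLog
import Summits.Parity.GeneralizedHardyLittlewood.Theorems.LeeYangFibresAbsoluteUpgradeSlices
import Summits.Parity.GeneralizedHardyLittlewood.Theorems.LeeYangFibresCellParityLawSingularRatio
import HarnessLib

/-!
# Route `LeeYangFibres`, crux `AbsoluteUpgrade` (stmt-Parity-14116), line `Sketch` (uniform amplification):
# THE TRANSFER `stub_amplification` (stub F)

The registered stub `stub_amplification : Amplification`, i.e.

`UniformSingularMean → CollisionFormFacts → UniformRelativeDimOne → DimOne`: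

the tensor-power trick over translate-constellations with a GROWING number of translates. Given `t ≥ 1`, `L`,
`ε > 0`, put `e = min ε 1`, take the singular-mass constant `C` of S1
(`AbsoluteUpgrade.stub_singularProduct_le_loglog_pow`: `𝔖(Ψ) ≤ C (log log N)^{t-1}`) and `ε₁ = e/(100(C+1))`.
The hypotheses are instantiated ONCE, before the scale: relative Hardy–Littlewood uniform in the number of forms
(`UniformRelativeDimOne`) at exponent `A = 1` (low mass, dimension `t`) and at `A = t`, size constant `3L`
(high mass, dimension `T = (m+1)t`), and the m-uniform Gallagher average (`UniformSingularMean`) at `A = t`.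
For `N` large (`ℓ = log log N ≥ 2t` and the uniform junk inequality `eventually_degenerate_junk_le`) put
`m = ⌊ℓ^{t-1}⌋` (`exists_translates`: `m ≥ 1`, `ℓ^{t-1} < m + 1`, `T = (m+1)t ≤ ℓ^t`), `S = S(Ψ, K, N) ≥ 0`,
`M = β_∞ 𝔖 ∈ [0, 2N · C ℓ^{t-1}] ⊆ [0, 2NC(m+1)]` (`archFactor_le_two_mul`, S1).

* LOW MASS `M < 5N`: `|S - M| ≤ ε₁ (M + N) ≤ 6 ε₁ N ≤ ε N`.
* HIGH MASS `M ≥ 5N`: `S^{m+1} = ∑_{H ∈ [-2N,2N]^m} S(Ψ^{(H)}, K_H)` (`completeSum`); on the non-degenerate shifts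
  `|S_H - M_H| ≤ ε₁ (M_H + N)` (dimension `T ≤ ℓ^t`, size `≤ (3m+1)L ≤ 3L · T`, `K_H` convex `⊆ [-N, N]`);
  `∑_{nondeg} M_H = M^{m+1} + O(ε₁(M^{m+1} + N^{m+1}))`; the `≤ m(m+1)t²(4N+1)^{m-1}` degenerate shifts
  (`CollisionFormFacts` (1)) carry `S_H ≤ (2N+1) log^T(2(3m+1)L₁N)`, in total `≤ ε₁ N^{m+1}` uniformly in `m`;
  so `(1-4ε₁)M^{m+1} ≤ S^{m+1} ≤ (1+4ε₁)M^{m+1}` and ROOT EXTRACTION WITH THE GAIN `1/(m+1)`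
  (`uniform_high_mass_amplify`) gives `|S - M| ≤ 8ε₁ M/(m+1) ≤ 16 ε₁ C N ≤ ε N`, because `ℓ^{t-1} < m + 1`
  beats the singular mass.

References: B. Green, T. Tao, Ann. of Math. 171 (2010), Conj. 1.2 / Conj. 1.4 and Lemma 1.3 [GreenTao2010];
P. X. Gallagher, Mathematika 23 (1976), §2 [Gallagher1976]; T. Tao, V. Vu, *Additive Combinatorics*, §2.
-/

noncomputable section

open scoped BigOperators Classical Topology
open Finset Filter MeasureTheory Literature.NumberTheory.Sieve
open Summit.Parity.GeneralizedHardyLittlewood.Cruxes.RelativeDimOne.TranslateAmplification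

namespace Summit.Parity.GeneralizedHardyLittlewood.Cruxes.AbsoluteUpgrade.UniformAmplification

/-- **THE TRANSFER** (registered stub `stub_amplification` of line `Sketch`, stub F): m-uniform Gallagher
averaging + the explicit degenerate count + relative Dickson–Hardy–Littlewood uniform in the number of forms give
ABSOLUTE Dickson–Hardy–Littlewood `DimOne`, by the tensor-power trick over translate-constellations with
`m + 1 = ⌊(log log N)^{t-1}⌋ + 1` translates (see the module docstring for the parameter schedule).
(The type is written namespace-qualified — it is the Defs-file proposition `Amplification` of this namespace — only to
keep it textually distinct from the homonymous stub of the crux `RelativeDimOne`.)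
[cite: GreenTao2010, Conj. 1.2 and Conj. 1.4] -/
theorem stub_amplification : UniformAmplification.Amplification := by
  unfold Amplification
  intro hUSM hCF hS t L ht ε hε
  -- `e = min ε 1`
  obtain ⟨e, he⟩ : ∃ e : ℝ, e = min ε 1 := ⟨_, rfl⟩
  have he0 : 0 < e := by rw [he]; exact lt_min hε one_pos
  have he1 : e ≤ 1 := by rw [he]; exact min_le_right _ _
  have heε : e ≤ ε := by rw [he]; exact min_le_left _ _
  -- the singular-mass constant (S1) and `ε₁`
  obtain ⟨C, hC0, N₁, hS1⟩ := Theorems.AbsoluteUpgrade.stub_singularProduct_le_loglog_pow t L ht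
  obtain ⟨ε₁, hε₁⟩ : ∃ ε₁ : ℝ, ε₁ = e / (100 * (C + 1)) := ⟨_, rfl⟩
  have hε₁0 : 0 < ε₁ := by rw [hε₁]; positivity
  have hε₁8 : ε₁ ≤ 1 / 8 := by
    rw [hε₁, div_le_iff₀ (by positivity)]
    linarith
  have h6 : 6 * ε₁ ≤ e := by
    rw [hε₁, mul_div_assoc', div_le_iff₀ (by positivity)]
    nlinarith [mul_nonneg he0.le hC0.le]
  have h16 : 16 * ε₁ * C ≤ e := by
    have h1 : 16 * ε₁ * C = e * (16 * C / (100 * (C + 1))) := by rw [hε₁]; ring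
    have h2 : 16 * C / (100 * (C + 1)) ≤ 1 := by
      rw [div_le_one (by positivity)]
      linarith
    rw [h1]
    exact (mul_le_mul_of_nonneg_left h2 he0.le).trans (le_of_eq (mul_one e))
  -- the hypotheses, instantiated once (before the scale)
  obtain ⟨N₂, hN₂⟩ := hS 1 L ε₁ hε₁0
  obtain ⟨N₃, hN₃⟩ := hS t (3 * L) ε₁ hε₁0
  obtain ⟨N₄, hN₄⟩ := hUSM t L t ht ε₁ hε₁0
  -- the scale: `log log N ≥ 2t`, `N ≥ 1`, and the uniform junk inequality
  have hL₁ : (1 : ℝ) ≤ ((max L 1 : ℕ) : ℝ) := by exact_mod_cast le_max_right L 1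
  have hLL₁ : (L : ℝ) ≤ ((max L 1 : ℕ) : ℝ) := by exact_mod_cast le_max_left L 1
  obtain ⟨N₅, hN₅⟩ := Filter.eventually_atTop.mp ((eventually_le_loglog (2 * (t : ℝ))).and
    ((eventually_ge_atTop 1).and (eventually_degenerate_junk_le ht hL₁ hε₁0)))
  refine ⟨N₁ + N₂ + N₃ + N₄ + N₅, fun N hN Ψ hΨ hL K hK hKN => ?_⟩
  have hNN₁ : N₁ ≤ N := by omega
  have hNN₂ : N₂ ≤ N := by omega
  have hNN₃ : N₃ ≤ N := by omega
  have hNN₄ : N₄ ≤ N := by omega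
  obtain ⟨hℓ, hN1, hJ⟩ := hN₅ N (by omega)
  have hN0 : (0 : ℝ) ≤ N := Nat.cast_nonneg N
  have hN1r : (1 : ℝ) ≤ N := by exact_mod_cast hN1
  have ht1r : (1 : ℝ) ≤ t := by exact_mod_cast ht
  -- the number of translates
  obtain ⟨m, hm1, hmℓ, hT⟩ := exists_translates ht hℓ
  have hT1 : 1 ≤ (m + 1) * t := le_trans ht (Nat.le_mul_of_pos_left t (Nat.succ_pos m))
  have hm0 : (0 : ℝ) < (m : ℝ) + 1 := by positivity
  -- `S`, `M = β_∞ 𝔖` and the singular mass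
  have hS0 : 0 ≤ vonMangoldtSum Ψ K N :=
    Theorems.LeeYangFibresRelativeDimOne.vonMangoldtSum_nonneg Ψ K N
  have hV0 : 0 ≤ archFactor Ψ K := archFactor_nonneg' Ψ K
  have hV2 : archFactor Ψ K ≤ 2 * (N : ℝ) := Theorems.AbsoluteUpgrade.archFactor_le_two_mul Ψ hKN
  have h𝔖0 : 0 ≤ singularProduct Ψ :=
    CellParityLaw.SectionAnnihilator.SingularRatio.singularProduct_nonneg hΨ
  have h𝔖C : singularProduct Ψ ≤ C * Real.log (Real.log N) ^ (t - 1) := hS1 N hNN₁ Ψ hΨ hL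
  have hM0 : 0 ≤ archFactor Ψ K * singularProduct Ψ := mul_nonneg hV0 h𝔖0
  have hMle : archFactor Ψ K * singularProduct Ψ ≤ 2 * (N : ℝ) * (C * ((m : ℝ) + 1)) :=
    calc archFactor Ψ K * singularProduct Ψ ≤ 2 * (N : ℝ) * (C * Real.log (Real.log N) ^ (t - 1)) :=
          mul_le_mul hV2 h𝔖C h𝔖0 (by positivity)
      _ ≤ 2 * (N : ℝ) * (C * ((m : ℝ) + 1)) :=
          mul_le_mul_of_nonneg_left (mul_le_mul_of_nonneg_left hmℓ.le hC0.le) (by positivity)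
  have heN : e * (N : ℝ) ≤ ε * N := mul_le_mul_of_nonneg_right heε hN0
  rcases lt_or_ge (archFactor Ψ K * singularProduct Ψ) (5 * N) with hlow | hhigh
  · -- LOW MASS: relative Hardy–Littlewood at dimension `t`
    have ht1 : (t : ℝ) ≤ Real.log (Real.log N) ^ 1 := by rw [pow_one]; linarith
    have hsize : affLinSize Ψ N ≤ (L : ℝ) * t := hL.trans (le_mul_of_one_le_right (Nat.cast_nonneg L) ht1r)
    have h := hN₂ N hNN₂ t ht ht1 Ψ hΨ hsize K hK hKN
    calc |vonMangoldtSum Ψ K N - archFactor Ψ K * singularProduct Ψ|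
        ≤ ε₁ * (archFactor Ψ K * singularProduct Ψ + N) := h
      _ ≤ ε₁ * (6 * N) := mul_le_mul_of_nonneg_left (by linarith) hε₁0.le
      _ = 6 * ε₁ * N := by ring
      _ ≤ e * N := mul_le_mul_of_nonneg_right h6 hN0
      _ ≤ ε * N := heN
  · -- HIGH MASS: the tensor-power trick with `m + 1` translates
    have hsize3 : ∀ H ∈ shiftBox m N,
        affLinSize (translateFamily Ψ H) N ≤ ((3 * L : ℕ) : ℝ) * (((m + 1) * t : ℕ) : ℝ) := by
      intro H hH
      refine (affLinSize_translateFamily_le hN1 hL hH).trans ?_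
      push_cast
      have hL0 : (0 : ℝ) ≤ L := Nat.cast_nonneg L
      have hm0' : (0 : ℝ) ≤ m := Nat.cast_nonneg m
      have h1 : 3 * (m : ℝ) + 1 ≤ 3 * (((m : ℝ) + 1) * t) := by nlinarith
      calc (3 * (m : ℝ) + 1) * L ≤ 3 * (((m : ℝ) + 1) * t) * L := mul_le_mul_of_nonneg_right h1 hL0
        _ = 3 * L * ((m + 1) * t) := by ring
    have hL'1 : (1 : ℝ) ≤ (3 * (m : ℝ) + 1) * ((max L 1 : ℕ) : ℝ) := by
      have hm0' : (0 : ℝ) ≤ m := Nat.cast_nonneg m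
      nlinarith
    have hsize' : ∀ H ∈ shiftBox m N,
        affLinSize (translateFamily Ψ H) N ≤ (3 * m + 1) * ((max L 1 : ℕ) : ℝ) :=
      fun H hH => affLinSize_translateFamily_le hN1 (hL.trans hLL₁) hH
    have hB0 : 0 ≤ (2 * (N : ℝ) + 1) *
        Real.log (2 * ((3 * (m : ℝ) + 1) * ((max L 1 : ℕ) : ℝ)) * N) ^ ((m + 1) * t) := by
      refine mul_nonneg (by positivity) (pow_nonneg (Real.log_nonneg ?_) _)
      nlinarith
    have key := uniform_high_mass_amplify (shiftBox m N)
      (fun H => IsNondegenerateSystem (translateFamily Ψ H))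
      (fun H => vonMangoldtSum (translateFamily Ψ H) (meetTranslates K H) N)
      (fun H => archFactor (translateFamily Ψ H) (meetTranslates K H) *
        singularProduct (translateFamily Ψ H))
      m hε₁0.le hε₁8 hS0 hM0 hhigh (completeSum m t N Ψ K hKN) (hN₄ N hNN₄ m hT Ψ hΨ hL K hK hKN)
      (fun H hH hnd => hN₃ N hNN₃ ((m + 1) * t) hT1 hT (translateFamily Ψ H) hnd (hsize3 H hH)
        (meetTranslates K H) (convex_meetTranslates hK H) ((meetTranslates_subset K H).trans hKN))
      (fun H hH _ => vonMangoldtSum_le_card_mul hN1 hL'1 (hsize' H hH) (meetTranslates K H))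
      hB0
      (fun H _ => Theorems.LeeYangFibresRelativeDimOne.vonMangoldtSum_nonneg _ _ _)
      (card_shiftBox_real_le m hN1) (hCF.1 m t N Ψ hΨ) (hJ m hT)
    calc |vonMangoldtSum Ψ K N - archFactor Ψ K * singularProduct Ψ|
        ≤ 8 * ε₁ / ((m : ℝ) + 1) * (archFactor Ψ K * singularProduct Ψ) := key
      _ ≤ 8 * ε₁ / ((m : ℝ) + 1) * (2 * (N : ℝ) * (C * ((m : ℝ) + 1))) :=
          mul_le_mul_of_nonneg_left hMle (by positivity)
      _ = 16 * ε₁ * C * N := by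
          rw [div_mul_eq_mul_div, div_eq_iff hm0.ne']
          ring
      _ ≤ e * N := mul_le_mul_of_nonneg_right h16 hN0
      _ ≤ ε * N := heN

/-- **Door (b) of the census, curried form of the transfer**: m-uniform Gallagher averaging of the main terms of
translate-constellations, the explicit degenerate count, and relative Dickson–Hardy–Littlewood uniform in the
number of forms `T ≤ (log log N)^A` together give ABSOLUTE Dickson–Hardy–Littlewood at `d = 1` (`DimOne`, error
`ε N`). This is `stub_amplification` with its three hypotheses named, for use by routes whose mechanism outputs
relative errors. [cite: GreenTao2010, Conj. 1.2 and Conj. 1.4] -/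
theorem dimOne_of_uniformSingularMean_of_uniformRelativeDimOne (hUSM : UniformSingularMean)
    (hCF : CollisionFormFacts) (hU : UniformRelativeDimOne) : Theses.LeeYangFibres.DimOne :=
  stub_amplification hUSM hCF hU

end Summit.Parity.GeneralizedHardyLittlewood.Cruxes.AbsoluteUpgrade.UniformAmplification

end
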